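import Summits.Ventures.HSemireg.WedgeHankelRecurrenceRouthInertia

/-!
# Venture HSemireg — THE TOP BORDERING OF A BEZOUTIAN: **`B_{k+1}(f, c·X·f + r) = c·v vᵀ + (B_k(f, r) ⊕ 0)`** (`v = (f_0, …, f_k)`, `deg f, deg r ≤ k`), hence for `f_k ≠ 0` the INERTIA
# **`sigPos B_{k+1}(f, c·X·f + r) = [c > 0] + sigPos B_k(f, r)`, `sigNeg B_{k+1}(f, c·X·f + r) = [c < 0] + sigNeg B_k(f, r)`** — the reduction of the SECOND argument modulo `X·f` AT THE
# LEADING COEFFICIENT (N202 ∕ N217 border at the constant term); packaged as the LEADING REDUCTION `sigPos B_{k+1}(f, q) = [q_{k+1}/f_k > 0] + sigPos B_k(f, q − (q_{k+1}/f_k)·X·f)` for `deg q ≤ k + 1`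

HONEST FRAMING. Part of the Lean index of the computation cell `pub-hsemireg` (seat p10 gen 40, Sunday typer «UNIFORM-IN-n»).
LINEAR ALGEBRA OF REAL SYMMETRIC MATRICES AND POLYNOMIALS ONLY (Mathlib `sigPos` ∕ `sigNeg`, `Matrix.PosDef`; PROVED Literature `Matrix/Bezoutian` and the `QuadraticForm` signature files
imported through N217): no variety, no cohomology theory, no sheaf, no Ext group and no semiregularity map is constructed here; nothing here says that HC / HC_CM / HC_AV holds; no Literature fact
(unproved `Prop`) is declared or used.  Custodian versions as in `WedgeHankelSiegelIdeal` (1/3).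
SOURCES (cited; held text read, `book:gantmacher1984-theory-matrices` chunks p0156–p0157 (Ch. XV §3, Routh's scheme (13)–(15) in the PRINTED, descending orientation) and p0192–p0197 (§14,
the step `g = c₀h + g₁`, `h = d₀·u·g₁ + h₁` of Stieltjes' continued fraction (102))).  The descending Routh ∕ Stieltjes step subtracts a multiple of `X·f` from the partner of HIGHER degree; on
Bezoutians this is the present «top bordering» (the dyad `B(f, Xf) = v vᵀ` of N202 §896 sits in the LAST coordinate `v_k = f_k` instead of the first).  O. Holtz, LAA 372 (2003) Thm 2 is the
ascending counterpart typed in N202 ∕ N217.  This file is the algebraic lemma behind gen 40's reading of Gantmacher XV §§14–16 (descending Routh step, Stieltjes' Thm 15, Markov's Thm 17).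
DEDUP DISCLOSURE (`rg -i 'castSucc|vecMulVec|bordering' Summits/Ventures/HSemireg`, `lean search`, 2026-09-02): N202 `bezoutian_self_X_mul` (`B(g, Xg) = v vᵀ`, USED), `dotProduct_bezoutian_routh_mulVec`
∕ `posDef_iff_of_border` ∕ N217 `sigPos_sigNeg_bezoutian_X_mul_routh` (border in coordinate `0`, second argument `X·g`); Literature `Bezoutian.bezCoeff_eq_zero_of_le_left ∕ _right` (USED).  No
statement in the tree borders a Bezoutian in the LAST coordinate or reduces the second argument at the leading coefficient.  The 15 names below: 0 hits tree-wide.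

WHAT IS IN THE TREE.  N202: `bezoutian_self_X_mul`; N217: `sigPos_sigNeg_smul_sq`; N189: `posDef_iff_sigPos_eq_card`, `sigPos_toQuadraticForm'_le_card`; N126: `sigPos_comp_eq_of_surjective`,
`sigNeg_comp_eq_of_surjective`; Literature `Bezoutian`: `bezoutian_apply`, `bezoutian_add_right`, `bezoutian_smul_right`, `bezoutian_isSymm`, `bezCoeff_eq_zero_of_le_left ∕ _right`; Literature
`MaslovIndexTransverse.sigPos_prod ∕ sigNeg_prod`, `DeterminantCharTwo.toQuadraticForm'_apply`.  Mathlib: `Fin.sum_univ_castSucc`, `Fin.snoc`, `Matrix.vecMulVec`, `QuadraticMap.sq ∕ prod ∕ comp`,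
`Fintype.linearCombination`, `LinearMap.funLeft`.
THIS FILE (namespace `Summit.Ventures.HSemireg.Wedge.HankelOuter` continued; PLAIN over N217; 0 definitions):
* §951 IDENTITIES (any commutative ring): `bezoutian_right_C_mul_X_mul_self_add` (`B_n(f, c·X·f + r) = c·v vᵀ + B_n(f, r)`), `bezoutian_succ_castSucc_castSucc` (the leading `k × k` block of
  `B_{k+1}(f, r)` is `B_k(f, r)`), `bezoutian_succ_last_right ∕ _left` (its last column ∕ row vanish when `deg f, deg r ≤ k`), `dotProduct_bezoutian_castSucc_mulVec`
  (`xᵀ B_{k+1}(f, r) x = x′ᵀ B_k(f, r) x′`, `x′ = x ∘ castSucc`), **`dotProduct_bezoutian_top_mulVec`** (`xᵀ B_{k+1}(f, c·X·f + r) x = c (v·x)² + x′ᵀ B_k(f, r) x′`).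
* §952 THE ORTHOGONAL SUM (over `ℝ`): `linearCombination_prod_funLeft_castSucc_surjective` (`x ↦ (v·x, x′)` is onto for `v_k ≠ 0`), `toQuadraticForm'_bezoutian_top_eq_prod_comp`,
  **`sigPos_sigNeg_bezoutian_top`** (the inertia form, `f_k ≠ 0`), `posDef_bezoutian_top_iff` (`B_{k+1}(f, c·X·f + r) ≻ 0 ⟺ 0 < c ∧ B_k(f, r) ≻ 0`).
* §953 THE LEADING REDUCTION (`deg f ≤ k`, `f_k ≠ 0`, `deg q ≤ k + 1`; `c = q_{k+1}/f_k`, `r = q − c·X·f` has `deg r ≤ k`): `natDegree_sub_C_mul_X_mul_le`, `eq_C_mul_X_mul_add_sub`,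
  **`sigPos_sigNeg_bezoutian_leading_reduction`**, **`posDef_bezoutian_iff_leading_reduction`**, `sigPos_sigNeg_bezoutian_succ_of_natDegree_le` (`deg q ≤ k`: the border alone).
CAVEATS.  Real coefficients for the inertia statements (§951 is over any commutative ring); the border needs `f_k ≠ 0` (otherwise `v_k = 0` and the pull-back is not onto).  Nothing Ext-side.
New names only.
-/

open Module Polynomial
open scoped Matrix Polynomial

namespace Summit.Ventures.HSemireg.Wedge.HankelOuter

open Summit.Ventures.HSemireg.Wedge Summit.Ventures.HSemireg.Wedge.Hankel
open Literature.LinearAlgebra.Matrix.Bezoutian (bezCoeff bezoutian bezoutian_apply bezoutian_isSymm bezoutian_add_right bezoutian_smul_right bezCoeff_eq_zero_of_le_left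
  bezCoeff_eq_zero_of_le_right)
open Literature.LinearAlgebra.QuadraticForm (sigPos_prod sigNeg_prod)
open Literature.LinearAlgebra.QuadraticForm.DeterminantCharTwo (toQuadraticForm'_apply)

/-! ## §951. Identities: the dyad at the top and the vanishing border -/

section Identities

variable {R : Type*} [CommRing R]

/-- **`B_n(f, c·X·f + r) = c·v vᵀ + B_n(f, r)`** with `v_i = f_i` (bilinearity and N202's `B(f, Xf) = v vᵀ`). [this file, §951] -/
theorem bezoutian_right_C_mul_X_mul_self_add (n : ℕ) (f r : R[X]) (c : R) :
    bezoutian n f (C c * (Polynomial.X * f) + r) = c • Matrix.vecMulVec (fun i : Fin n => f.coeff i) (fun j : Fin n => f.coeff j) + bezoutian n f r := by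
  rw [bezoutian_add_right, ← smul_eq_C_mul, bezoutian_smul_right, bezoutian_self_X_mul]

/-- The leading `k × k` block of `B_{k+1}(f, r)` is `B_k(f, r)` (same array `b_{ij}`). [this file, §951] -/
theorem bezoutian_succ_castSucc_castSucc (k : ℕ) (f r : R[X]) (i j : Fin k) :
    bezoutian (k + 1) f r i.castSucc j.castSucc = bezoutian k f r i j := by
  rw [bezoutian_apply, bezoutian_apply, Fin.val_castSucc, Fin.val_castSucc]

/-- The last column of `B_{k+1}(f, r)` vanishes when `deg f, deg r ≤ k`. [Literature `bezCoeff_eq_zero_of_le_right`; this file, §951] -/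
theorem bezoutian_succ_last_right {k : ℕ} {f r : R[X]} (hf : f.natDegree ≤ k) (hr : r.natDegree ≤ k) (i : Fin (k + 1)) :
    bezoutian (k + 1) f r i (Fin.last k) = 0 := by
  rw [bezoutian_apply, Fin.val_last]
  exact bezCoeff_eq_zero_of_le_right hf hr le_rfl _

/-- The last row of `B_{k+1}(f, r)` vanishes when `deg f, deg r ≤ k`. [Literature `bezCoeff_eq_zero_of_le_left`; this file, §951] -/
theorem bezoutian_succ_last_left {k : ℕ} {f r : R[X]} (hf : f.natDegree ≤ k) (hr : r.natDegree ≤ k) (j : Fin (k + 1)) :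
    bezoutian (k + 1) f r (Fin.last k) j = 0 := by
  rw [bezoutian_apply, Fin.val_last]
  exact bezCoeff_eq_zero_of_le_left hf hr le_rfl _

/-- **`xᵀ B_{k+1}(f, r) x = x′ᵀ B_k(f, r) x′`** with `x′ = x ∘ castSucc`, when `deg f, deg r ≤ k` (the border vanishes). [this file, §951] -/
theorem dotProduct_bezoutian_castSucc_mulVec {k : ℕ} {f r : R[X]} (hf : f.natDegree ≤ k) (hr : r.natDegree ≤ k) (x : Fin (k + 1) → R) :
    x ⬝ᵥ (bezoutian (k + 1) f r *ᵥ x) = (x ∘ Fin.castSucc) ⬝ᵥ (bezoutian k f r *ᵥ (x ∘ Fin.castSucc)) := by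
  have hrow : ∀ j : Fin (k + 1), bezoutian (k + 1) f r (Fin.last k) j = 0 := bezoutian_succ_last_left hf hr
  have hcol : ∀ i : Fin (k + 1), bezoutian (k + 1) f r i (Fin.last k) = 0 := bezoutian_succ_last_right hf hr
  simp only [dotProduct, Matrix.mulVec, Fin.sum_univ_castSucc, hrow, hcol, bezoutian_succ_castSucc_castSucc, zero_mul, mul_zero, Finset.sum_const_zero, add_zero,
    Function.comp_apply]

/-- **THE TOP BORDERING: `xᵀ B_{k+1}(f, c·X·f + r) x = c·(Σ f_i x_i)² + x′ᵀ B_k(f, r) x′`** (`x′ = x ∘ castSucc`; `deg f, deg r ≤ k`). [this file, §951] -/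
theorem dotProduct_bezoutian_top_mulVec {k : ℕ} {f r : R[X]} (hf : f.natDegree ≤ k) (hr : r.natDegree ≤ k) (c : R) (x : Fin (k + 1) → R) :
    x ⬝ᵥ (bezoutian (k + 1) f (C c * (Polynomial.X * f) + r) *ᵥ x)
      = c * ((fun i : Fin (k + 1) => f.coeff i) ⬝ᵥ x) ^ 2 + (x ∘ Fin.castSucc) ⬝ᵥ (bezoutian k f r *ᵥ (x ∘ Fin.castSucc)) := by
  -- the quadratic form of a dyad: `xᵀ (v vᵀ) x = (v·x)²` (folklore; inlined as in N202)
  have hdyad : ∀ v : Fin (k + 1) → R, x ⬝ᵥ (Matrix.vecMulVec v v *ᵥ x) = (v ⬝ᵥ x) ^ 2 := fun v => by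
    simp only [dotProduct, Matrix.mulVec, Matrix.vecMulVec_apply, sq, Finset.sum_mul_sum]
    refine Finset.sum_congr rfl fun i _ => ?_
    rw [Finset.mul_sum]
    exact Finset.sum_congr rfl fun j _ => by ring
  rw [bezoutian_right_C_mul_X_mul_self_add, Matrix.add_mulVec, dotProduct_add, Matrix.smul_mulVec, dotProduct_smul, hdyad, dotProduct_bezoutian_castSucc_mulVec hf hr, smul_eq_mul]

end Identities

/-! ## §952. Over `ℝ`: the orthogonal sum and its inertia -/

section OrthogonalSum

/-- The map `x ↦ (v·x, (x_0, …, x_{k−1}))` from `ℝ^{k+1}` to `ℝ × ℝ^k` is onto when `v_k ≠ 0`. [bookkeeping; this file, §952] -/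
theorem linearCombination_prod_funLeft_castSucc_surjective {k : ℕ} {v : Fin (k + 1) → ℝ} (hv : v (Fin.last k) ≠ 0) :
    Function.Surjective ((Fintype.linearCombination ℝ v).prod (LinearMap.funLeft ℝ ℝ (Fin.castSucc : Fin k → Fin (k + 1)))) := by
  rintro ⟨a, y⟩
  refine ⟨Fin.snoc y ((a - ∑ i : Fin k, y i * v i.castSucc) / v (Fin.last k)), Prod.ext ?_ ?_⟩
  · show Fintype.linearCombination ℝ v (Fin.snoc y ((a - ∑ i : Fin k, y i * v i.castSucc) / v (Fin.last k))) = a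
    rw [Fintype.linearCombination_apply, Fin.sum_univ_castSucc]
    simp only [Fin.snoc_castSucc, Fin.snoc_last, smul_eq_mul]
    rw [div_mul_cancel₀ _ hv]
    ring
  · show (Fin.snoc y ((a - ∑ i : Fin k, y i * v i.castSucc) / v (Fin.last k)) : Fin (k + 1) → ℝ) ∘ Fin.castSucc = y
    funext i
    simp

/-- **The quadratic form of `B_{k+1}(f, c·X·f + r)` is the orthogonal sum `(c·t²) ⊥ q_{B_k(f, r)}` pulled back along `x ↦ (v·x, x′)`**, `v = (f_0, …, f_k)`, `x′ = x ∘ castSucc` (`deg f, deg r ≤ k`).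
[this file, §952] -/
theorem toQuadraticForm'_bezoutian_top_eq_prod_comp {k : ℕ} {f r : ℝ[X]} (hf : f.natDegree ≤ k) (hr : r.natDegree ≤ k) (c : ℝ) :
    (bezoutian (k + 1) f (C c * (Polynomial.X * f) + r)).toQuadraticForm'
      = ((c • (QuadraticMap.sq : QuadraticForm ℝ ℝ)).prod (bezoutian k f r).toQuadraticForm').comp
          ((Fintype.linearCombination ℝ (fun i : Fin (k + 1) => f.coeff i)).prod (LinearMap.funLeft ℝ ℝ (Fin.castSucc : Fin k → Fin (k + 1)))) := by
  ext x
  have hL : ((Fintype.linearCombination ℝ fun i : Fin (k + 1) => f.coeff i).prod (LinearMap.funLeft ℝ ℝ (Fin.castSucc : Fin k → Fin (k + 1)))) x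
      = ((fun i : Fin (k + 1) => f.coeff i) ⬝ᵥ x, x ∘ Fin.castSucc) := by
    refine Prod.ext ?_ rfl
    show Fintype.linearCombination ℝ (fun i : Fin (k + 1) => f.coeff i) x = _
    rw [Fintype.linearCombination_apply, dotProduct]
    exact Finset.sum_congr rfl fun i _ => by rw [smul_eq_mul, mul_comm]
  rw [QuadraticMap.comp_apply, hL, QuadraticMap.prod_apply, toQuadraticForm'_apply, toQuadraticForm'_apply, dotProduct_bezoutian_top_mulVec hf hr, QuadraticMap.smul_apply,
    QuadraticMap.sq_apply, smul_eq_mul, sq]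

/-- **THE INERTIA FORM OF THE TOP BORDERING: `sigPos B_{k+1}(f, c·X·f + r) = [c > 0] + sigPos B_k(f, r)` and `sigNeg B_{k+1}(f, c·X·f + r) = [c < 0] + sigNeg B_k(f, r)`** for `deg f, deg r ≤ k`,
`f_k ≠ 0` (Sylvester's law along the onto pull-back, additivity on the orthogonal sum). [the descending Routh ∕ Stieltjes step on inertia; this file, §952] -/
theorem sigPos_sigNeg_bezoutian_top {k : ℕ} {f r : ℝ[X]} (hf : f.natDegree ≤ k) (hfk : f.coeff k ≠ 0) (hr : r.natDegree ≤ k) (c : ℝ) :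
    sigPos (bezoutian (k + 1) f (C c * (Polynomial.X * f) + r)).toQuadraticForm' = (if 0 < c then 1 else 0) + sigPos (bezoutian k f r).toQuadraticForm'
      ∧ sigNeg (bezoutian (k + 1) f (C c * (Polynomial.X * f) + r)).toQuadraticForm' = (if c < 0 then 1 else 0) + sigNeg (bezoutian k f r).toQuadraticForm' := by
  have hv : (fun i : Fin (k + 1) => f.coeff i) (Fin.last k) ≠ 0 := by
    show f.coeff (Fin.last k : ℕ) ≠ 0
    rw [Fin.val_last]; exact hfk
  have hsurj := linearCombination_prod_funLeft_castSucc_surjective (v := fun i : Fin (k + 1) => f.coeff i) hv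
  obtain ⟨h1, h2⟩ := sigPos_sigNeg_smul_sq c
  rw [toQuadraticForm'_bezoutian_top_eq_prod_comp hf hr, sigPos_comp_eq_of_surjective _ hsurj, sigNeg_comp_eq_of_surjective _ hsurj, sigPos_prod, sigNeg_prod, h1, h2]
  exact ⟨rfl, rfl⟩

/-- **`B_{k+1}(f, c·X·f + r) ≻ 0 ⟺ 0 < c ∧ B_k(f, r) ≻ 0`** (`deg f, deg r ≤ k`, `f_k ≠ 0`): a positive definite form has full `sigPos` on both summands. [this file, §952] -/
theorem posDef_bezoutian_top_iff {k : ℕ} {f r : ℝ[X]} (hf : f.natDegree ≤ k) (hfk : f.coeff k ≠ 0) (hr : r.natDegree ≤ k) (c : ℝ) :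
    (bezoutian (k + 1) f (C c * (Polynomial.X * f) + r)).PosDef ↔ 0 < c ∧ (bezoutian k f r).PosDef := by
  rw [posDef_iff_sigPos_eq_card (bezoutian_isSymm _ _ _), posDef_iff_sigPos_eq_card (bezoutian_isSymm _ _ _), (sigPos_sigNeg_bezoutian_top hf hfk hr c).1, Fintype.card_fin, Fintype.card_fin]
  have hb := sigPos_toQuadraticForm'_le_card (bezoutian k f r)
  rw [Fintype.card_fin] at hb
  constructor
  · intro h
    by_cases hc : 0 < c
    · rw [if_pos hc] at h; exact ⟨hc, by omega⟩
    · rw [if_neg hc] at h; omega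
  · rintro ⟨hc, h⟩
    rw [if_pos hc, h, add_comm]

end OrthogonalSum

/-! ## §953. The leading reduction of the second argument -/

section LeadingReduction

/-- For `deg f ≤ k`, `f_k ≠ 0`, `deg q ≤ k + 1` and `c = q_{k+1}/f_k`: **`deg (q − c·X·f) ≤ k`** (the top coefficients cancel). [bookkeeping; this file, §953] -/
theorem natDegree_sub_C_mul_X_mul_le {k : ℕ} {f q : ℝ[X]} (hf : f.natDegree ≤ k) (hfk : f.coeff k ≠ 0) (hq : q.natDegree ≤ k + 1) :
    (q - C (q.coeff (k + 1) / f.coeff k) * (Polynomial.X * f)).natDegree ≤ k := by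
  have hXf : (Polynomial.X * f).natDegree ≤ k + 1 := by
    calc (Polynomial.X * f).natDegree ≤ Polynomial.X.natDegree + f.natDegree := natDegree_mul_le
      _ ≤ 1 + k := by rw [natDegree_X]; omega
      _ = k + 1 := add_comm _ _
  have hle : (q - C (q.coeff (k + 1) / f.coeff k) * (Polynomial.X * f)).natDegree ≤ k + 1 :=
    (natDegree_sub_le _ _).trans (max_le hq ((natDegree_C_mul_le _ _).trans hXf))
  have htop : (q - C (q.coeff (k + 1) / f.coeff k) * (Polynomial.X * f)).coeff (k + 1) = 0 := by
    rw [coeff_sub, coeff_C_mul, coeff_X_mul, div_mul_cancel₀ _ hfk, sub_self]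
  rcases hle.lt_or_eq with h | h
  · exact Nat.lt_succ_iff.1 h
  exfalso
  have hne : (q - C (q.coeff (k + 1) / f.coeff k) * (Polynomial.X * f)) ≠ 0 := by
    intro h0; rw [h0, natDegree_zero] at h; omega
  have := leadingCoeff_ne_zero.2 hne
  rw [leadingCoeff, h, htop] at this
  exact this rfl

/-- `q = c·X·f + (q − c·X·f)`. [bookkeeping; this file, §953] -/
theorem eq_C_mul_X_mul_add_sub (f q : ℝ[X]) (c : ℝ) : q = C c * (Polynomial.X * f) + (q - C c * (Polynomial.X * f)) := by ring

/-- **THE LEADING REDUCTION ON INERTIA: for `deg f ≤ k`, `f_k ≠ 0`, `deg q ≤ k + 1`, with `c = q_{k+1}/f_k`: `sigPos B_{k+1}(f, q) = [c > 0] + sigPos B_k(f, q − c·X·f)` and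
`sigNeg B_{k+1}(f, q) = [c < 0] + sigNeg B_k(f, q − c·X·f)`.** [the descending Routh ∕ Stieltjes step; this file, §953] -/
theorem sigPos_sigNeg_bezoutian_leading_reduction {k : ℕ} {f q : ℝ[X]} (hf : f.natDegree ≤ k) (hfk : f.coeff k ≠ 0) (hq : q.natDegree ≤ k + 1) :
    sigPos (bezoutian (k + 1) f q).toQuadraticForm'
        = (if 0 < q.coeff (k + 1) / f.coeff k then 1 else 0) + sigPos (bezoutian k f (q - C (q.coeff (k + 1) / f.coeff k) * (Polynomial.X * f))).toQuadraticForm'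
      ∧ sigNeg (bezoutian (k + 1) f q).toQuadraticForm'
        = (if q.coeff (k + 1) / f.coeff k < 0 then 1 else 0) + sigNeg (bezoutian k f (q - C (q.coeff (k + 1) / f.coeff k) * (Polynomial.X * f))).toQuadraticForm' := by
  have h := sigPos_sigNeg_bezoutian_top hf hfk (natDegree_sub_C_mul_X_mul_le hf hfk hq) (q.coeff (k + 1) / f.coeff k)
  rwa [← eq_C_mul_X_mul_add_sub f q] at h

/-- **`B_{k+1}(f, q) ≻ 0 ⟺ 0 < q_{k+1}/f_k ∧ B_k(f, q − (q_{k+1}/f_k)·X·f) ≻ 0`** (`deg f ≤ k`, `f_k ≠ 0`, `deg q ≤ k + 1`). [this file, §953] -/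
theorem posDef_bezoutian_iff_leading_reduction {k : ℕ} {f q : ℝ[X]} (hf : f.natDegree ≤ k) (hfk : f.coeff k ≠ 0) (hq : q.natDegree ≤ k + 1) :
    (bezoutian (k + 1) f q).PosDef ↔ 0 < q.coeff (k + 1) / f.coeff k ∧ (bezoutian k f (q - C (q.coeff (k + 1) / f.coeff k) * (Polynomial.X * f))).PosDef := by
  have h := posDef_bezoutian_top_iff hf hfk (natDegree_sub_C_mul_X_mul_le hf hfk hq) (q.coeff (k + 1) / f.coeff k)
  rwa [← eq_C_mul_X_mul_add_sub f q] at h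

/-- **No top term (`deg q ≤ k`): `sigPos B_{k+1}(f, q) = sigPos B_k(f, q)` and `sigNeg B_{k+1}(f, q) = sigNeg B_k(f, q)`** (`deg f ≤ k`, `f_k ≠ 0`; the border is zero). [this file, §953] -/
theorem sigPos_sigNeg_bezoutian_succ_of_natDegree_le {k : ℕ} {f q : ℝ[X]} (hf : f.natDegree ≤ k) (hfk : f.coeff k ≠ 0) (hq : q.natDegree ≤ k) :
    sigPos (bezoutian (k + 1) f q).toQuadraticForm' = sigPos (bezoutian k f q).toQuadraticForm'
      ∧ sigNeg (bezoutian (k + 1) f q).toQuadraticForm' = sigNeg (bezoutian k f q).toQuadraticForm' := by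
  have hq0 : q.coeff (k + 1) = 0 := coeff_eq_zero_of_natDegree_lt (Nat.lt_succ_of_le hq)
  have h := sigPos_sigNeg_bezoutian_leading_reduction hf hfk (hq.trans (Nat.le_succ k))
  rw [hq0, zero_div, map_zero, zero_mul, sub_zero, if_neg (lt_irrefl _), zero_add, zero_add] at h
  exact h

end LeadingReduction

end Summit.Ventures.HSemireg.Wedge.HankelOuter
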